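import Mathlib
import HarnessLib

/-!
# Finite-dimensional `su(2)` multiplets with a one-dimensional weight-zero space

Trunk T-QLATTICE, family `hubbard`. The angular-momentum algebra behind the phrase "unique
apart from the trivial `(2S+1)`-fold degeneracy" in Lieb, PRL 62 (1989) 1201, Theorems 1–2, in
matrix form: a triple of complex matrices `(S⁺, S⁻, S^z)` with `S⁻ = (S⁺)†`, `S^z` Hermitian,
`[S⁺, S⁻] = 2S^z`, `[S^z, S^±] = ±S^±` (`IsSu2Triple`), its Casimir
`C = (S^z)² + ½(S⁺S⁻ + S⁻S⁺)` (`su2Casimir`; for the Hubbard operators of `HubbardWave0` this is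
literally `spinSq`), and a subspace `V` stable under `S^±` and spanned by vectors of integer
weight lying in `V`. `IsSu2Triple.su2_multiplet`: (1) `V ≠ 0` contains a nonzero weight-`0` vector;
(2) if the weight-`0` part of `V` is a line `ℂψ₀` and `Cψ₀ = J(J+1)ψ₀` (`J ∈ ℕ`), then
`dim V = 2J+1` and `C = J(J+1)` on `V`. The proof is the standard raising/lowering argument
(norm identity `‖S⁻v‖² = ‖S⁺v‖² + 2m‖v‖²`, the string `S⁻^J ψ₀, …, S⁺^J ψ₀`, linear independence
of eigenvectors with distinct eigenvalues); Tasaki (2020) §2.4 and Appendix A.3. No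
representation theory from Mathlib is used beyond `Module.End.eigenvectors_linearIndependent'`.
All statements are folklore. (Names `IsSu2Triple`/`su2Casimir` follow the review of p9182.)
-/

noncomputable section

namespace Literature.MathematicalPhysics.QuantumLattice

open Matrix
open scoped ComplexOrder

section Su2

variable {ι : Type*} [Fintype ι] [DecidableEq ι]

/-- The `su(2)` Casimir `C = Z² + ½(P M + M P)` of a raising operator `P = S⁺`, lowering operator
`M = S⁻` and Cartan element `Z = S^z` (for the Hubbard model this is `HubbardWave0.spinSq`).
Lieb, PRL 62 (1989) 1201, eq. (2). [cite: LiebPRL1989, eq. (2)] -/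
def su2Casimir (P M Z : Matrix ι ι ℂ) : Matrix ι ι ℂ := Z * Z + (1 / 2 : ℂ) • (P * M + M * P)

/-- The `su(2)` relations of a spin triple `(S⁺, S⁻, S^z)` of matrices: `S⁻ = (S⁺)†`, `S^z`
Hermitian, `[S⁺, S⁻] = 2S^z`, `[S^z, S^±] = ±S^±`. Tasaki (2020) §2.4, (2.4.5)–(2.4.7);
Lieb, PRL 62 (1989) 1201, eq. (2). [folklore] -/
structure IsSu2Triple (P M Z : Matrix ι ι ℂ) : Prop where
  /-- `S⁻ = (S⁺)†` -/
  adj : M = Pᴴ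
  /-- `S^z` is Hermitian -/
  herm : Zᴴ = Z
  /-- `[S⁺, S⁻] = 2 S^z` -/
  comm_PM : P * M - M * P = (2 : ℂ) • Z
  /-- `[S^z, S⁺] = S⁺` -/
  comm_ZP : Z * P - P * Z = P
  /-- `[S^z, S⁻] = -S⁻` -/
  comm_ZM : Z * M - M * Z = -M

namespace IsSu2Triple

variable {P M Z : Matrix ι ι ℂ}

omit [DecidableEq ι] in
/-- `[S^z, S⁻] = -S⁻` follows from the other relations by taking adjoints. [folklore] -/
theorem mk' (adj : M = Pᴴ) (herm : Zᴴ = Z) (comm_PM : P * M - M * P = (2 : ℂ) • Z)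
    (comm_ZP : Z * P - P * Z = P) : IsSu2Triple P M Z := by
  refine ⟨adj, herm, comm_PM, comm_ZP, ?_⟩
  have h := congrArg conjTranspose comm_ZP
  rw [conjTranspose_sub, conjTranspose_mul, conjTranspose_mul, herm, ← adj] at h
  calc Z * M - M * Z = -(M * Z - Z * M) := by abel
    _ = -M := by rw [h]

omit [DecidableEq ι] in
/-- `Z P = P Z + P`. [folklore] -/
theorem ZP (h : IsSu2Triple P M Z) : Z * P = P * Z + P := by
  have h1 := h.comm_ZP
  calc Z * P = (Z * P - P * Z) + P * Z := by abel
    _ = P * Z + P := by rw [h1]; abel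

omit [DecidableEq ι] in
/-- `Z M = M Z - M`. [folklore] -/
theorem ZM (h : IsSu2Triple P M Z) : Z * M = M * Z - M := by
  have h1 := h.comm_ZM
  calc Z * M = (Z * M - M * Z) + M * Z := by abel
    _ = M * Z - M := by rw [h1]; abel

omit [DecidableEq ι] in
/-- `P M = M P + 2 Z` (written `Z + Z`). [folklore] -/
theorem PM (h : IsSu2Triple P M Z) : P * M = M * P + (Z + Z) := by
  have h1 := h.comm_PM
  calc P * M = (P * M - M * P) + M * P := by abel
    _ = M * P + (Z + Z) := by rw [h1, two_smul]; abel

omit [DecidableEq ι] in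
/-- The mirror triple `(S⁻, S⁺, -S^z)` satisfies the same relations (exchanges raising and
lowering). [folklore] -/
theorem mirror (h : IsSu2Triple P M Z) : IsSu2Triple M P (-Z) := by
  refine ⟨by rw [h.adj, conjTranspose_conjTranspose], by rw [conjTranspose_neg, h.herm], ?_, ?_, ?_⟩
  · calc M * P - P * M = -(P * M - M * P) := by abel
      _ = (2 : ℂ) • (-Z) := by rw [h.comm_PM, smul_neg]
  · calc -Z * M - M * -Z = -(Z * M - M * Z) := by rw [neg_mul, mul_neg]; abel
      _ = M := by rw [h.comm_ZM, neg_neg]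
  · calc -Z * P - P * -Z = -(Z * P - P * Z) := by rw [neg_mul, mul_neg]; abel
      _ = -P := by rw [h.comm_ZP]

omit [DecidableEq ι] in
/-- `C = Z² + Z + M P`. [folklore] -/
theorem su2Casimir_eq (h : IsSu2Triple P M Z) : su2Casimir P M Z = Z * Z + Z + M * P := by
  rw [su2Casimir, h.PM, show M * P + (Z + Z) + M * P = (2 : ℂ) • (M * P + Z) by
    rw [two_smul]; abel, smul_smul]
  norm_num
  abel

omit [DecidableEq ι] in
/-- `C = Z² - Z + P M`. [folklore] -/
theorem su2Casimir_eq' (h : IsSu2Triple P M Z) : su2Casimir P M Z = Z * Z - Z + P * M := by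
  rw [h.su2Casimir_eq, h.PM]; abel

omit [DecidableEq ι] in
/-- The Casimir of the mirror triple is the same matrix. [folklore] -/
theorem su2Casimir_mirror (P M Z : Matrix ι ι ℂ) : su2Casimir M P (-Z) = su2Casimir P M Z := by
  rw [su2Casimir, su2Casimir, neg_mul_neg, add_comm (M * P)]

omit [DecidableEq ι] in
/-- `[C, S⁺] = 0`. Tasaki (2020) §2.4. [folklore] -/
theorem su2Casimir_mul_P (h : IsSu2Triple P M Z) : su2Casimir P M Z * P = P * su2Casimir P M Z := by
  have hZP := h.ZP
  have hPM := h.PM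
  have h1 : Z * Z * P = P * Z * Z + P * Z + P * Z + P := by
    calc Z * Z * P = Z * (Z * P) := by noncomm_ring
      _ = Z * (P * Z + P) := by rw [hZP]
      _ = (Z * P) * Z + Z * P := by noncomm_ring
      _ = (P * Z + P) * Z + (P * Z + P) := by rw [hZP]
      _ = _ := by noncomm_ring
  have h2 : M * P * P = P * M * P - ((P * Z + P) + (P * Z + P)) := by
    calc M * P * P = (M * P) * P := by noncomm_ring
      _ = (P * M - (Z + Z)) * P := by rw [hPM]; noncomm_ring
      _ = P * M * P - (Z * P + Z * P) := by noncomm_ring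
      _ = _ := by rw [hZP]
  have h3 : Z * P + M * P * P = (P * Z + P) + (P * M * P - ((P * Z + P) + (P * Z + P))) := by
    rw [h2, hZP]
  rw [h.su2Casimir_eq]
  calc (Z * Z + Z + M * P) * P = Z * Z * P + (Z * P + M * P * P) := by noncomm_ring
    _ = (P * Z * Z + P * Z + P * Z + P) + ((P * Z + P) + (P * M * P - ((P * Z + P) + (P * Z + P)))) := by
        rw [h1, h3]
    _ = P * (Z * Z + Z + M * P) := by noncomm_ring

omit [DecidableEq ι] in
/-- `[C, S^z] = 0`. Tasaki (2020) §2.4. [folklore] -/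
theorem su2Casimir_mul_Z (h : IsSu2Triple P M Z) : su2Casimir P M Z * Z = Z * su2Casimir P M Z := by
  have hZP := h.ZP
  have hZM := h.ZM
  rw [h.su2Casimir_eq]
  calc (Z * Z + Z + M * P) * Z = Z * Z * Z + Z * Z + M * (P * Z) := by noncomm_ring
    _ = Z * Z * Z + Z * Z + M * (Z * P - P) := by
        rw [hZP]; noncomm_ring
    _ = Z * Z * Z + Z * Z + (M * Z) * P - M * P := by noncomm_ring
    _ = Z * Z * Z + Z * Z + (Z * M + M) * P - M * P := by
        rw [hZM]; noncomm_ring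
    _ = Z * (Z * Z + Z + M * P) := by noncomm_ring

omit [DecidableEq ι] in
/-- `[C, S⁻] = 0`. Tasaki (2020) §2.4. [folklore] -/
theorem su2Casimir_mul_M (h : IsSu2Triple P M Z) : su2Casimir P M Z * M = M * su2Casimir P M Z := by
  have h' := h.mirror.su2Casimir_mul_P
  rwa [su2Casimir_mirror] at h'

/-- `C` commutes with powers of `S⁻`. [folklore] -/
theorem su2Casimir_mul_M_pow (h : IsSu2Triple P M Z) (k : ℕ) : su2Casimir P M Z * M ^ k = M ^ k * su2Casimir P M Z :=
  (Commute.pow_right h.su2Casimir_mul_M k : _)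

/-- `C` commutes with powers of `S⁺`. [folklore] -/
theorem su2Casimir_mul_P_pow (h : IsSu2Triple P M Z) (k : ℕ) : su2Casimir P M Z * P ^ k = P ^ k * su2Casimir P M Z :=
  (Commute.pow_right h.su2Casimir_mul_P k : _)

omit [DecidableEq ι] in
/-- `S⁺` raises the weight by one. [folklore] -/
theorem weight_P (h : IsSu2Triple P M Z) {v : ι → ℂ} {c : ℂ} (hv : Z *ᵥ v = c • v) :
    Z *ᵥ (P *ᵥ v) = (c + 1) • (P *ᵥ v) := by
  rw [mulVec_mulVec, h.ZP, add_mulVec, ← mulVec_mulVec, hv, mulVec_smul, add_smul, one_smul]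

omit [DecidableEq ι] in
/-- `S⁻` lowers the weight by one. [folklore] -/
theorem weight_M (h : IsSu2Triple P M Z) {v : ι → ℂ} {c : ℂ} (hv : Z *ᵥ v = c • v) :
    Z *ᵥ (M *ᵥ v) = (c - 1) • (M *ᵥ v) := by
  rw [mulVec_mulVec, h.ZM, sub_mulVec, ← mulVec_mulVec, hv, mulVec_smul, sub_smul, one_smul]

/-- `S⁻^k` lowers the weight by `k`. [folklore] -/
theorem weight_M_pow (h : IsSu2Triple P M Z) {v : ι → ℂ} {c : ℂ} (hv : Z *ᵥ v = c • v) (k : ℕ) :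
    Z *ᵥ (M ^ k *ᵥ v) = (c - k) • (M ^ k *ᵥ v) := by
  induction k with
  | zero => simp [hv]
  | succ k ih =>
    rw [pow_succ', ← mulVec_mulVec, h.weight_M ih]
    congr 1; push_cast; ring

/-- `S⁺^k` raises the weight by `k`. [folklore] -/
theorem weight_P_pow (h : IsSu2Triple P M Z) {v : ι → ℂ} {c : ℂ} (hv : Z *ᵥ v = c • v) (k : ℕ) :
    Z *ᵥ (P ^ k *ᵥ v) = (c + k) • (P ^ k *ᵥ v) := by
  induction k with
  | zero => simp [hv]
  | succ k ih =>
    rw [pow_succ', ← mulVec_mulVec, h.weight_P ih]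
    congr 1; push_cast; ring

/-- `C` acts on `P^k v` as on `v` (eigenvalue transported). [folklore] -/
theorem su2Casimir_P_pow (h : IsSu2Triple P M Z) {v : ι → ℂ} {l : ℂ} (hv : su2Casimir P M Z *ᵥ v = l • v) (k : ℕ) :
    su2Casimir P M Z *ᵥ (P ^ k *ᵥ v) = l • (P ^ k *ᵥ v) := by
  rw [mulVec_mulVec, h.su2Casimir_mul_P_pow, ← mulVec_mulVec, hv, mulVec_smul]

omit [DecidableEq ι] in
/-- `⟨M v, w⟩ = ⟨v, P w⟩`. [folklore] -/
theorem star_M_mulVec_dotProduct (h : IsSu2Triple P M Z) (v w : ι → ℂ) :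
    star (M *ᵥ v) ⬝ᵥ w = star v ⬝ᵥ (P *ᵥ w) := by
  rw [h.adj, star_mulVec, conjTranspose_conjTranspose, dotProduct_mulVec]

omit [DecidableEq ι] in
/-- `⟨P v, w⟩ = ⟨v, M w⟩`. [folklore] -/
theorem star_P_mulVec_dotProduct (h : IsSu2Triple P M Z) (v w : ι → ℂ) :
    star (P *ᵥ v) ⬝ᵥ w = star v ⬝ᵥ (M *ᵥ w) := by
  rw [h.adj, star_mulVec, dotProduct_mulVec]

omit [DecidableEq ι] in
/-- Norm identity `‖S⁻v‖² = ‖S⁺v‖² + 2m‖v‖²` on a weight-`m` vector. Tasaki (2020) §2.4. [folklore] -/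
theorem norm_M_eq (h : IsSu2Triple P M Z) {v : ι → ℂ} {c : ℂ} (hv : Z *ᵥ v = c • v) :
    star (M *ᵥ v) ⬝ᵥ (M *ᵥ v) = star (P *ᵥ v) ⬝ᵥ (P *ᵥ v) + 2 * c * (star v ⬝ᵥ v) := by
  rw [h.star_M_mulVec_dotProduct, h.star_P_mulVec_dotProduct, mulVec_mulVec, mulVec_mulVec, h.PM,
    add_mulVec, add_mulVec, hv, dotProduct_add, dotProduct_add, dotProduct_smul, smul_eq_mul]
  ring

omit [DecidableEq ι] in
/-- Injectivity of `S⁻` on positive weights: `Z v = m v`, `m > 0`, `S⁻ v = 0 ⟹ v = 0`. Tasaki (2020) §2.4. [folklore] -/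
theorem eq_zero_of_M_eq_zero (h : IsSu2Triple P M Z) {v : ι → ℂ} {m : ℝ} (hm : 0 < m)
    (hv : Z *ᵥ v = (m : ℂ) • v) (hMv : M *ᵥ v = 0) : v = 0 := by
  have key := h.norm_M_eq hv
  rw [hMv, dotProduct_zero] at key
  have h1 : 0 ≤ star (P *ᵥ v) ⬝ᵥ (P *ᵥ v) := dotProduct_star_self_nonneg _
  have h2 : 0 ≤ star v ⬝ᵥ v := dotProduct_star_self_nonneg _
  have h3 : 0 ≤ 2 * (m : ℂ) * (star v ⬝ᵥ v) :=
    mul_nonneg (mul_nonneg zero_le_two (by exact_mod_cast hm.le)) h2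
  have h4 : 2 * (m : ℂ) * (star v ⬝ᵥ v) = 0 := le_antisymm (by rw [key]; exact le_add_of_nonneg_left h1) h3
  rcases mul_eq_zero.1 h4 with h5 | h5
  · rcases mul_eq_zero.1 h5 with h6 | h6
    · norm_num at h6
    · exact absurd (by exact_mod_cast h6 : m = 0) hm.ne'
  · exact dotProduct_star_self_eq_zero.1 h5

/-- Iterated injectivity: on a vector of natural weight `m ≥ k`, `S⁻^k v = 0 ⟹ v = 0`. [folklore] -/
theorem eq_zero_of_M_pow_eq_zero (h : IsSu2Triple P M Z) :
    ∀ (k : ℕ) {v : ι → ℂ} {m : ℕ}, k ≤ m → Z *ᵥ v = (m : ℂ) • v → M ^ k *ᵥ v = 0 → v = 0 := by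
  intro k
  induction k with
  | zero => intro v m _ _ h0; simpa using h0
  | succ k ih =>
    intro v m hkm hv hMv
    rw [pow_succ, ← mulVec_mulVec] at hMv
    have hm1 : 1 ≤ m := le_trans (Nat.succ_le_succ (Nat.zero_le k)) hkm
    have hv' : Z *ᵥ (M *ᵥ v) = ((m - 1 : ℕ) : ℂ) • (M *ᵥ v) := by
      rw [h.weight_M hv, Nat.cast_sub hm1, Nat.cast_one]
    have hMv0 : M *ᵥ v = 0 := ih (by omega) hv' hMv
    exact h.eq_zero_of_M_eq_zero (m := m) (by exact_mod_cast hm1) (by exact_mod_cast hv) hMv0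

end IsSu2Triple

end Su2

end Literature.MathematicalPhysics.QuantumLattice

namespace Literature.MathematicalPhysics.QuantumLattice

open Matrix
open scoped ComplexOrder

namespace IsSu2Triple

variable {ι : Type*} [Fintype ι] [DecidableEq ι] {P M Z : Matrix ι ι ℂ}

/-- Powers of an operator preserving `V` preserve `V`. [folklore] -/
theorem pow_mulVec_mem {A : Matrix ι ι ℂ} {V : Submodule ℂ (ι → ℂ)} (hA : ∀ v ∈ V, A *ᵥ v ∈ V)
    (k : ℕ) {v : ι → ℂ} (hv : v ∈ V) : A ^ k *ᵥ v ∈ V := by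
  induction k with
  | zero => simpa using hv
  | succ k ih => rw [pow_succ', ← mulVec_mulVec]; exact hA _ ih

/-- `S⁻ S⁺ (S⁺^k ψ₀) = (λ - k² - k) S⁺^k ψ₀` for a weight-`0` vector `ψ₀` with `C ψ₀ = λ ψ₀`
(`S⁻S⁺ = C - (S^z)² - S^z`). Tasaki (2020) §2.4. [folklore] -/
theorem M_P_pow_succ (h : IsSu2Triple P M Z) {ψ₀ : ι → ℂ} (hZ0 : Z *ᵥ ψ₀ = 0) {l : ℂ}
    (hC : su2Casimir P M Z *ᵥ ψ₀ = l • ψ₀) (k : ℕ) :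
    M *ᵥ (P ^ (k + 1) *ᵥ ψ₀) = (l - k * k - k) • (P ^ k *ᵥ ψ₀) := by
  have hZ0' : Z *ᵥ ψ₀ = (0 : ℂ) • ψ₀ := by rw [hZ0, zero_smul]
  have hu : Z *ᵥ (P ^ k *ᵥ ψ₀) = (k : ℂ) • (P ^ k *ᵥ ψ₀) := by
    have := h.weight_P_pow hZ0' k; rwa [zero_add] at this
  have hCu := h.su2Casimir_P_pow hC k
  have hMP : M * P = su2Casimir P M Z - Z * Z - Z := by rw [h.su2Casimir_eq]; abel
  rw [pow_succ', ← mulVec_mulVec, mulVec_mulVec, hMP, sub_mulVec, sub_mulVec, ← mulVec_mulVec, hu,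
    mulVec_smul, hu, hCu, smul_smul, sub_smul, sub_smul]

/-- `S⁻^k S⁺^k ψ₀ = (Π_{i<k} (λ - i² - i)) ψ₀`. [folklore] -/
theorem M_pow_P_pow (h : IsSu2Triple P M Z) {ψ₀ : ι → ℂ} (hZ0 : Z *ᵥ ψ₀ = 0) {l : ℂ}
    (hC : su2Casimir P M Z *ᵥ ψ₀ = l • ψ₀) (k : ℕ) :
    M ^ k *ᵥ (P ^ k *ᵥ ψ₀) = (∏ i ∈ Finset.range k, (l - i * i - i)) • ψ₀ := by
  induction k with
  | zero => simp
  | succ k ih =>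
    rw [pow_succ, ← mulVec_mulVec, h.M_P_pow_succ hZ0 hC k, mulVec_smul, ih, smul_smul,
      Finset.prod_range_succ, mul_comm]

/-- The raising string does not break before `J`: `S⁺^k ψ₀ ≠ 0` for `k ≤ J` when
`C ψ₀ = J(J+1) ψ₀`, `S^z ψ₀ = 0`, `ψ₀ ≠ 0`. Tasaki (2020) §2.4. [folklore] -/
theorem P_pow_ne_zero (h : IsSu2Triple P M Z) {ψ₀ : ι → ℂ} (hψ₀ : ψ₀ ≠ 0) (hZ0 : Z *ᵥ ψ₀ = 0) (J : ℕ)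
    (hC : su2Casimir P M Z *ᵥ ψ₀ = ((J : ℂ) * (J + 1)) • ψ₀) {k : ℕ} (hk : k ≤ J) : P ^ k *ᵥ ψ₀ ≠ 0 := by
  intro h0
  have key := h.M_pow_P_pow hZ0 hC k
  rw [h0, mulVec_zero] at key
  have hprod : (∏ i ∈ Finset.range k, ((J : ℂ) * (J + 1) - i * i - i)) ≠ 0 := by
    rw [Finset.prod_ne_zero_iff]
    intro i hi
    rw [Finset.mem_range] at hi
    have h1 : ((J : ℂ) * (J + 1) - i * i - i) = ((J : ℂ) - i) * ((J : ℂ) + i + 1) := by ring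
    rw [h1]
    refine mul_ne_zero ?_ ?_
    · rw [sub_ne_zero]; exact_mod_cast (by omega : J ≠ i)
    · exact_mod_cast (by omega : J + i + 1 ≠ 0)
  exact hψ₀ ((smul_eq_zero.1 key.symm).resolve_left hprod)

/-- The raising string breaks after `J`: `S⁺^{J+1} ψ₀ = 0` (since `‖S⁺ u_J‖² = (λ - J² - J)‖u_J‖² = 0`).
Tasaki (2020) §2.4. [folklore] -/
theorem P_pow_succ_eq_zero (h : IsSu2Triple P M Z) {ψ₀ : ι → ℂ} (hZ0 : Z *ᵥ ψ₀ = 0) (J : ℕ)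
    (hC : su2Casimir P M Z *ᵥ ψ₀ = ((J : ℂ) * (J + 1)) • ψ₀) : P ^ (J + 1) *ᵥ ψ₀ = 0 := by
  have key : star (P ^ (J + 1) *ᵥ ψ₀) ⬝ᵥ (P ^ (J + 1) *ᵥ ψ₀) = 0 := by
    have e : P ^ (J + 1) *ᵥ ψ₀ = P *ᵥ (P ^ J *ᵥ ψ₀) := by rw [pow_succ', mulVec_mulVec]
    rw [e, h.star_P_mulVec_dotProduct, ← e, h.M_P_pow_succ hZ0 hC J, dotProduct_smul, smul_eq_mul]
    ring
  exact dotProduct_star_self_eq_zero.1 key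

/-- **Structure of the nonnegative-weight part of an `su(2)`-module with a one-dimensional
weight-zero space.** If `V` is stable under `S^±`, its weight-`0` subspace is the line `ℂψ₀` and
`C ψ₀ = J(J+1) ψ₀`, then every vector of natural weight `m` in `V` is an eigenvector of `C` with
eigenvalue `J(J+1)` and a multiple of `S⁺^m ψ₀` (in particular zero for `m > J`).
Tasaki (2020) §2.4 (structure of irreducible representations). [folklore] -/
theorem weight_vector_structure (h : IsSu2Triple P M Z) (V : Submodule ℂ (ι → ℂ))
    (hMV : ∀ v ∈ V, M *ᵥ v ∈ V) {ψ₀ : ι → ℂ} (hZ0 : Z *ᵥ ψ₀ = 0)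
    (hW0 : ∀ v ∈ V, Z *ᵥ v = 0 → ∃ c : ℂ, v = c • ψ₀) (J : ℕ)
    (hC : su2Casimir P M Z *ᵥ ψ₀ = ((J : ℂ) * (J + 1)) • ψ₀) (m : ℕ) {v : ι → ℂ} (hv : v ∈ V)
    (hZv : Z *ᵥ v = (m : ℂ) • v) :
    su2Casimir P M Z *ᵥ v = ((J : ℂ) * (J + 1)) • v ∧ ∃ c : ℂ, v = c • (P ^ m *ᵥ ψ₀) := by
  set l : ℂ := (J : ℂ) * (J + 1) with hl
  have hMmV : M ^ m *ᵥ v ∈ V := pow_mulVec_mem hMV m hv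
  have hZMm : Z *ᵥ (M ^ m *ᵥ v) = 0 := by
    have := h.weight_M_pow hZv m; rwa [sub_self, zero_smul] at this
  obtain ⟨c, hc⟩ := hW0 _ hMmV hZMm
  -- the Casimir eigenvalue
  have hCv : su2Casimir P M Z *ᵥ v = l • v := by
    have key : M ^ m *ᵥ (su2Casimir P M Z *ᵥ v - l • v) = 0 := by
      rw [mulVec_sub, mulVec_smul, mulVec_mulVec, ← h.su2Casimir_mul_M_pow, ← mulVec_mulVec, hc, mulVec_smul,
        hC, smul_smul, smul_smul, mul_comm, sub_self]
    have hwt' : Z *ᵥ (su2Casimir P M Z *ᵥ v - l • v) = (m : ℂ) • (su2Casimir P M Z *ᵥ v - l • v) := by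
      rw [mulVec_sub, mulVec_smul, mulVec_mulVec, ← h.su2Casimir_mul_Z, ← mulVec_mulVec, hZv, mulVec_smul,
        smul_sub, smul_comm]
    exact sub_eq_zero.1 (h.eq_zero_of_M_pow_eq_zero m le_rfl hwt' key)
  refine ⟨hCv, ?_⟩
  by_cases hmJ : m ≤ J
  · -- `v` is proportional to `S⁺^m ψ₀`
    set c' : ℂ := ∏ i ∈ Finset.range m, (l - i * i - i) with hc'
    have hc'v : M ^ m *ᵥ (P ^ m *ᵥ ψ₀) = c' • ψ₀ := h.M_pow_P_pow hZ0 hC m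
    have hc'0 : c' ≠ 0 := by
      rw [hc', Finset.prod_ne_zero_iff]
      intro i hi
      rw [Finset.mem_range] at hi
      have h1 : (l - i * i - i) = ((J : ℂ) - i) * ((J : ℂ) + i + 1) := by rw [hl]; ring
      rw [h1]
      refine mul_ne_zero ?_ ?_
      · rw [sub_ne_zero]; exact_mod_cast (by omega : J ≠ i)
      · exact_mod_cast (by omega : J + i + 1 ≠ 0)
    have hZu : Z *ᵥ (P ^ m *ᵥ ψ₀) = (m : ℂ) • (P ^ m *ᵥ ψ₀) := by
      have := h.weight_P_pow (show Z *ᵥ ψ₀ = (0 : ℂ) • ψ₀ by rw [hZ0, zero_smul]) m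
      rwa [zero_add] at this
    have key : M ^ m *ᵥ (c' • v - c • (P ^ m *ᵥ ψ₀)) = 0 := by
      rw [mulVec_sub, mulVec_smul, mulVec_smul, hc, hc'v, smul_smul, smul_smul, mul_comm, sub_self]
    have hwt' : Z *ᵥ (c' • v - c • (P ^ m *ᵥ ψ₀)) = (m : ℂ) • (c' • v - c • (P ^ m *ᵥ ψ₀)) := by
      rw [mulVec_sub, mulVec_smul, mulVec_smul, hZv, hZu, smul_sub, smul_comm _ c', smul_comm _ c]
    have h0 := h.eq_zero_of_M_pow_eq_zero m le_rfl hwt' key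
    refine ⟨c / c', ?_⟩
    rw [sub_eq_zero] at h0
    calc v = c'⁻¹ • (c' • v) := by rw [smul_smul, inv_mul_cancel₀ hc'0, one_smul]
      _ = (c / c') • (P ^ m *ᵥ ψ₀) := by rw [h0, smul_smul, div_eq_inv_mul]
  · -- `m > J`: `v = 0` since `‖S⁺ v‖² = (J-m)(J+m+1) ‖v‖²`
    push Not at hmJ
    have hMP : M * P = su2Casimir P M Z - Z * Z - Z := by rw [h.su2Casimir_eq]; abel
    have hnorm : star (P *ᵥ v) ⬝ᵥ (P *ᵥ v) = (l - m * m - m) * (star v ⬝ᵥ v) := by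
      rw [h.star_P_mulVec_dotProduct, mulVec_mulVec, hMP, sub_mulVec, sub_mulVec, hCv, ← mulVec_mulVec, hZv,
        mulVec_smul, hZv, smul_smul, dotProduct_sub, dotProduct_sub, dotProduct_smul, dotProduct_smul,
        dotProduct_smul, smul_eq_mul, smul_eq_mul, smul_eq_mul]
      ring
    have hcoef : (l - m * m - m) = ((((J : ℝ) - m) * ((J : ℝ) + m + 1) : ℝ) : ℂ) := by
      rw [hl]; push_cast; ring
    have hr : ((J : ℝ) - m) * ((J : ℝ) + m + 1) < 0 :=
      mul_neg_of_neg_of_pos (by exact_mod_cast (by omega : (J : ℤ) - m < 0)) (by positivity)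
    have hv0 : v = 0 := by
      by_contra hv0
      obtain ⟨hqre, hqim⟩ := Complex.pos_iff.1 (dotProduct_star_self_pos_iff.2 hv0)
      obtain ⟨hpre, -⟩ := Complex.nonneg_iff.1 (dotProduct_star_self_nonneg (P *ᵥ v))
      rw [hnorm, hcoef, Complex.mul_re, Complex.ofReal_re, Complex.ofReal_im, zero_mul, sub_zero] at hpre
      have := mul_neg_of_neg_of_pos hr hqre
      linarith
    exact ⟨0, by rw [hv0, zero_smul]⟩

/-- **Structure of a finite-dimensional `su(2)`-module with one-dimensional weight-zero space**
(the angular-momentum algebra behind "unique apart from the trivial `(2S+1)`-fold degeneracy"):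
let `(S⁺, S⁻, S^z)` satisfy the `su(2)` relations and let `V` be a subspace stable under `S^±`
which is spanned by vectors of integer weight lying in `V`. Then
(1) if `V ≠ 0`, `V` contains a nonzero vector of weight `0`;
(2) if the weight-`0` part of `V` is a line `ℂψ₀` with `C ψ₀ = J(J+1) ψ₀` (`J ∈ ℕ`), then
`dim V = 2J + 1` and `C = J(J+1)` on `V` (`V` is the spin-`J` multiplet through `ψ₀`, with basis
`S⁻^J ψ₀, …, ψ₀, …, S⁺^J ψ₀`). Tasaki (2020) §2.4, Appendix A.3; Lieb, PRL 62 (1989) 1201 ("by the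
well known properties of angular momentum"). [folklore] -/
theorem su2_multiplet (h : IsSu2Triple P M Z) (V : Submodule ℂ (ι → ℂ))
    (hPV : ∀ v ∈ V, P *ᵥ v ∈ V) (hMV : ∀ v ∈ V, M *ᵥ v ∈ V)
    (hwt : ∀ v ∈ V, ∃ (s : Finset ℤ) (w : ℤ → ι → ℂ),
      (∀ m ∈ s, w m ∈ V ∧ Z *ᵥ w m = (m : ℂ) • w m) ∧ v = ∑ m ∈ s, w m) :
    (V ≠ ⊥ → ∃ v ∈ V, v ≠ 0 ∧ Z *ᵥ v = 0) ∧
      ∀ (ψ₀ : ι → ℂ) (J : ℕ), ψ₀ ∈ V → ψ₀ ≠ 0 → Z *ᵥ ψ₀ = 0 →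
        (∀ v ∈ V, Z *ᵥ v = 0 → ∃ c : ℂ, v = c • ψ₀) →
        su2Casimir P M Z *ᵥ ψ₀ = ((J : ℂ) * (J + 1)) • ψ₀ →
        Module.finrank ℂ V = 2 * J + 1 ∧ ∀ v ∈ V, su2Casimir P M Z *ᵥ v = ((J : ℂ) * (J + 1)) • v := by
  have h' := h.mirror
  -- weights of the mirror triple
  have hneg : ∀ {w : ι → ℂ} {k : ℕ}, Z *ᵥ w = ((-(k : ℤ) : ℤ) : ℂ) • w → (-Z) *ᵥ w = (k : ℂ) • w := by
    intro w k hw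
    rw [neg_mulVec, hw, Int.cast_neg, Int.cast_natCast, neg_smul, neg_neg]
  constructor
  · -- (1) a nonzero weight-zero vector
    intro hV
    obtain ⟨v, hv, hv0⟩ := (Submodule.ne_bot_iff V).1 hV
    obtain ⟨s, w, hw, rfl⟩ := hwt v hv
    obtain ⟨m, hm, hwm⟩ : ∃ m ∈ s, w m ≠ 0 := by
      by_contra hall
      push Not at hall
      exact hv0 (Finset.sum_eq_zero hall)
    obtain ⟨hwV, hwZ⟩ := hw m hm
    obtain ⟨k, rfl | rfl⟩ := Int.eq_nat_or_neg m
    · refine ⟨M ^ k *ᵥ w k, pow_mulVec_mem hMV k hwV, fun h0 => hwm ?_, ?_⟩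
      · exact h.eq_zero_of_M_pow_eq_zero k le_rfl (by exact_mod_cast hwZ) h0
      · have := h.weight_M_pow (c := (k : ℂ)) (by exact_mod_cast hwZ) k
        rwa [sub_self, zero_smul] at this
    · have hwZ' : (-Z) *ᵥ w (-(k : ℤ)) = (k : ℂ) • w (-(k : ℤ)) := hneg hwZ
      refine ⟨P ^ k *ᵥ w (-(k : ℤ)), pow_mulVec_mem hPV k hwV, fun h0 => hwm ?_, ?_⟩
      · exact h'.eq_zero_of_M_pow_eq_zero k le_rfl hwZ' h0
      · have := h'.weight_M_pow hwZ' k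
        rw [sub_self, zero_smul, neg_mulVec, neg_eq_zero] at this
        exact this
  · -- (2) the multiplet through `ψ₀`
    intro ψ₀ J hψ₀V hψ₀ hZ0 hW0 hC
    set l : ℂ := (J : ℂ) * (J + 1) with hl
    have hZ0' : (-Z) *ᵥ ψ₀ = 0 := by rw [neg_mulVec, hZ0, neg_zero]
    have hW0' : ∀ v ∈ V, (-Z) *ᵥ v = 0 → ∃ c : ℂ, v = c • ψ₀ := fun v hv hZv =>
      hW0 v hv (by rwa [neg_mulVec, neg_eq_zero] at hZv)
    have hC' : su2Casimir M P (-Z) *ᵥ ψ₀ = l • ψ₀ := by rw [su2Casimir_mirror]; exact hC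
    have half := fun (m : ℕ) (v : ι → ℂ) (hv : v ∈ V) (hZv : Z *ᵥ v = (m : ℂ) • v) =>
      h.weight_vector_structure V hMV hZ0 hW0 J hC m hv hZv
    have half' := fun (m : ℕ) (v : ι → ℂ) (hv : v ∈ V) (hZv : (-Z) *ᵥ v = (m : ℂ) • v) =>
      h'.weight_vector_structure V hPV hZ0' hW0' J hC' m hv hZv
    -- the Casimir on all weight vectors of `V`, hence on `V`
    have hCw : ∀ (m : ℤ) (w : ι → ℂ), w ∈ V → Z *ᵥ w = (m : ℂ) • w → su2Casimir P M Z *ᵥ w = l • w := by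
      intro m w hwV hwZ
      obtain ⟨k, rfl | rfl⟩ := Int.eq_nat_or_neg m
      · exact (half k w hwV (by exact_mod_cast hwZ)).1
      · have := (half' k w hwV (hneg hwZ)).1
        rwa [su2Casimir_mirror] at this
    have hCV : ∀ v ∈ V, su2Casimir P M Z *ᵥ v = l • v := by
      intro v hv
      obtain ⟨s, w, hw, rfl⟩ := hwt v hv
      rw [mulVec_sum, Finset.smul_sum]
      exact Finset.sum_congr rfl fun m hm => hCw m (w m) (hw m hm).1 (hw m hm).2
    refine ⟨?_, hCV⟩
    -- the basis `S⁻^J ψ₀, …, ψ₀, …, S⁺^J ψ₀`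
    set g : Fin (2 * J + 1) → ι → ℂ :=
      fun i => if J ≤ (i : ℕ) then P ^ ((i : ℕ) - J) *ᵥ ψ₀ else M ^ (J - (i : ℕ)) *ᵥ ψ₀ with hg
    set μ : Fin (2 * J + 1) → ℂ := fun i => ((i : ℕ) : ℂ) - J with hμ
    have hZψ₀ : Z *ᵥ ψ₀ = (0 : ℂ) • ψ₀ := by rw [hZ0, zero_smul]
    have hZψ₀' : (-Z) *ᵥ ψ₀ = (0 : ℂ) • ψ₀ := by rw [hZ0', zero_smul]
    have hg_eig : ∀ i, Z *ᵥ g i = μ i • g i := by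
      intro i
      by_cases hi : J ≤ (i : ℕ)
      · simp only [hg, hμ, if_pos hi]
        have := h.weight_P_pow hZψ₀ ((i : ℕ) - J)
        rw [zero_add, Nat.cast_sub hi] at this
        exact this
      · simp only [hg, hμ, if_neg hi]
        have := h.weight_M_pow hZψ₀ (J - (i : ℕ))
        rw [zero_sub, Nat.cast_sub (le_of_lt (not_le.1 hi))] at this
        rw [this, neg_sub]
    have hg_ne : ∀ i, g i ≠ 0 := by
      intro i
      have hi2 : (i : ℕ) ≤ 2 * J := Nat.lt_succ_iff.1 i.2
      by_cases hi : J ≤ (i : ℕ)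
      · simp only [hg, if_pos hi]
        exact h.P_pow_ne_zero hψ₀ hZ0 J hC (by omega)
      · simp only [hg, if_neg hi]
        exact h'.P_pow_ne_zero hψ₀ hZ0' J hC' (by omega)
    have hg_mem : ∀ i, g i ∈ V := by
      intro i
      by_cases hi : J ≤ (i : ℕ)
      · simp only [hg, if_pos hi]; exact pow_mulVec_mem hPV _ hψ₀V
      · simp only [hg, if_neg hi]; exact pow_mulVec_mem hMV _ hψ₀V
    have hμ_inj : Function.Injective μ := by
      intro i j hij
      simp only [hμ, sub_left_inj, Nat.cast_inj] at hij
      exact Fin.ext hij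
    have hli : LinearIndependent ℂ g :=
      Module.End.eigenvectors_linearIndependent' (Matrix.toLin' Z) μ hμ_inj g fun i =>
        ⟨Module.End.mem_eigenspace_iff.2 (by rw [Matrix.toLin'_apply]; exact hg_eig i), hg_ne i⟩
    -- every weight vector of `V` lies in the span of the basis
    have hPJ : P ^ (J + 1) *ᵥ ψ₀ = 0 := h.P_pow_succ_eq_zero hZ0 J hC
    have hMJ : M ^ (J + 1) *ᵥ ψ₀ = 0 := h'.P_pow_succ_eq_zero hZ0' J hC'
    have hspan_w : ∀ (m : ℤ) (w : ι → ℂ), w ∈ V → Z *ᵥ w = (m : ℂ) • w →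
        w ∈ Submodule.span ℂ (Set.range g) := by
      intro m w hwV hwZ
      obtain ⟨k, rfl | rfl⟩ := Int.eq_nat_or_neg m
      · obtain ⟨c, hc⟩ := (half k w hwV (by exact_mod_cast hwZ)).2
        rw [hc]
        refine Submodule.smul_mem _ c ?_
        by_cases hk : k ≤ J
        · refine Submodule.subset_span ⟨⟨k + J, by omega⟩, ?_⟩
          simp only [hg]
          rw [if_pos (by simp : J ≤ k + J), Nat.add_sub_cancel]
        · have : P ^ k *ᵥ ψ₀ = 0 := by
            rw [show k = (k - (J + 1)) + (J + 1) by omega, pow_add, ← mulVec_mulVec, hPJ, mulVec_zero]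
          rw [this]; exact Submodule.zero_mem _
      · obtain ⟨c, hc⟩ := (half' k w hwV (hneg hwZ)).2
        rw [hc]
        refine Submodule.smul_mem _ c ?_
        by_cases hk : k ≤ J
        · refine Submodule.subset_span ⟨⟨J - k, by omega⟩, ?_⟩
          simp only [hg]
          by_cases hk0 : k = 0
          · subst hk0; simp
          · rw [if_neg (by simp; omega), Nat.sub_sub_self hk]
        · have : M ^ k *ᵥ ψ₀ = 0 := by
            rw [show k = (k - (J + 1)) + (J + 1) by omega, pow_add, ← mulVec_mulVec, hMJ, mulVec_zero]
          rw [this]; exact Submodule.zero_mem _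
    have hspan : V = Submodule.span ℂ (Set.range g) := by
      apply le_antisymm
      · intro v hv
        obtain ⟨s, w, hw, rfl⟩ := hwt v hv
        exact Submodule.sum_mem _ fun m hm => hspan_w m (w m) (hw m hm).1 (hw m hm).2
      · rw [Submodule.span_le]
        rintro _ ⟨i, rfl⟩
        exact hg_mem i
    rw [hspan, finrank_span_eq_card hli, Fintype.card_fin]

end IsSu2Triple

end Literature.MathematicalPhysics.QuantumLattice
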